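import Literature.MathematicalPhysics.QuantumFieldTheory.MullerSchiemann1987.MS87CentralAngle
import HarnessLib

/-!
# Müller–Schiemann, *Continuum limit of a hierarchical SU(2) lattice gauge theory in 4 dimensions*
# (CMP 110, 1987), THEOREM 2 PART 3) (p.281) AND ITS PRINTED PROOF: `θ²(e^{−ixσ₃}, iy) = z²` near `z = 0`
# from Proposition 1 (identity theorem), the region `𝒢[z, ϱ]` of (2.18), and
# «Property (A₂) then implies 3)» — PROVED (the model enters through (2.8) and (A₂) as hypotheses)

statement-level skeleton of published theorems with citation tags; proofs where landed; nothing here is a claim about the Yang–Mills mass gap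

**Citation header (reproduction of PUBLISHED work).** V. F. Müller, J. Schiemann, *Continuum limit of a hierarchical
SU(2) lattice gauge theory in 4 dimensions*, Commun. Math. Phys. **110** (1987) 261–286, doi 10.1007/BF01207367
[MullerSchiemann1987]; (2.13) p.264, (2.17)–(2.18) p.265, (A₂) p.267, Theorem 2 part 3) and (6.15) p.281 (held Project
Euclid scan `paper:url-96df5da18d4c`; displays read by this seat on its own 3× page renders
`run/shared/lean/pub/lit-balaban/lit-balaban-p12/renders-cmp110ms/ms87-cmp110-pdfp005,007,021-…-x3.png`).  Lean lane of
the lit-balaban YM LIT SWEEP CONTEXT row X1 (register level; zero weight for any token of that table); the model is the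
`d = 4` HIERARCHICAL `SU(2)` gauge model, NOT lattice Yang–Mills.

**What the paper prints.** (2.18) p.265: *«For later convenience we define particular subsets of G. Let z ∈ ℂ, |z| < ¼,
and ϱ ∈ ℝ₊, ϱ < ¼. Then 𝒢[z, ϱ] := {u ∈ G : u₀ > 0 and |θ²(u, z)| < ϱ²}.»* (A₂) p.267: *«For y ∈ ℝ, |y| < (κ/2)β^{−α} and
u ∈ G∖𝒢[iy, β^{−α}], |g̃(u, iy)| < exp{βy² − pβ^{1−2α}}»*. Theorem 2 part 3) p.281: *«For z = x + iy, with x, y ∈ ℝ,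
|z| > (β_N^{(−n)})^{−α}, |x| ≦ π, |y| < (κ/2)(β_N^{(−n)})^{−α}, |h_N^{(−n)}(z)| < exp{β_N^{(−n)}y² − p(β_N^{(−n)})^{1−2α}}.»*
Its proof p.281: *«In proving 3) we suppress subscript N and superscript (−n). From the definition (2.10) and the symmetry
(2.8) we obtain ∀z ∈ ℂ h(z) = g̃(e₀, z) = g̃(e^{−ixσ₃}, iy). (6.15) Proposition 1 shows for |z| sufficiently small
|θ(e^{−ixσ₃}, iy)| = |z|. Property (A₂) then implies 3).»*

**What this file proves (kernel-checked, 0 sorry, standard axioms; one definition, (2.18); no named fact).** With the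
sibling `MS87CentralAngle`'s `fC = f`, `etaOf`, `thetaSq = θ²` ((2.13)) and `MS87HeatKernelGroup`'s `diagPhase x =
e^{−ixσ₃}`, `u0`, `u3`:
* §1–§2 **«Proposition 1 shows for |z| sufficiently small |θ(e^{−ixσ₃}, iy)| = |z|»**: `‖cos w − 1‖ ≤ 2‖w‖` on
  `‖w‖ ≤ 1` (`norm_cos_sub_one_le`), so `η = ½(1 − cos w)` stays in the unit disc, and
  `4f(½(1 − cos w)) = w²` for ALL complex `‖w‖ < 1` (`four_fC_half_one_sub_cos_complex`: identity theorem on the unit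
  disc from the sibling's real-angle identity `four_fC_half_one_sub_cos`); with (2.17) for `u = e^{−ixσ₃}` (`u₀ = cos x`,
  `u₃ = −sin x`): `η(e^{−ixσ₃}, z′) = ½(1 − cos(x + z′))` (`etaOf_diagPhase`) and **`θ²(e^{−ixσ₃}, z′) = (x + z′)²`**
  for `‖x + z′‖ < 1` (`thetaSq_diagPhase`), in particular `|θ²(e^{−ixσ₃}, iy)| = |z|²`, `z = x + iy`
  (`norm_thetaSq_diagPhase`).
* §3 **(2.18)** `regionG z ϱ = 𝒢[z, ϱ]` (definition) and `e^{−ixσ₃} ∉ 𝒢[iy, ϱ]` whenever `ϱ ≤ |z| < 1`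
  (`diagPhase_not_mem_regionG`).
* §4 **THEOREM 2 PART 3), MODEL-FREE** (`thm2_part3`): for ANY `g̃ : G × ℂ → ℂ` with the symmetry (2.8)
  `g̃(e^{−ixσ₃}u, z) = g̃(u, x + z)` and the bound (A₂) at scale `β`, the function `h(z) = g̃(e₀, z)` ((6.15)) obeys
  `|h(z)| < exp{βy² − pβ^{1−2α}}` for `z = x + iy` with `β^{−α} ≤ |z| < 1`, `|y| < (κ/2)β^{−α}`.

**Readings / scope (declared).** (i) The tree models `g̃` for the heat-kernel action only (`MS87HeatKernelGroup.gTildeHK`,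
which has (2.8) as `gTildeHK_diagPhase_mul`); 3) concerns all iterates `h_N^{(−n)}`, so `thm2_part3` is stated for an
arbitrary `g̃` with (2.8) and (A₂) as hypotheses — exactly the two inputs the printed proof names. (ii) The print's range
is `|z| > β^{−α}`, `|x| ≤ π`; here `β^{−α} ≤ |z| < 1` — the regime «|z| sufficiently small» where the printed sentence
`|θ(e^{−ixσ₃}, iy)| = |z|` holds as the identity `θ² = z²` (for `|z| ≥ 1` the exclusion `e^{−ixσ₃} ∉ 𝒢[iy, β^{−α}]` is
not derived here). (iii) Only `θ²` (no branch of `θ`) is used, as in (2.18).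

**Not claimed.** Theorem 2 parts 1), 2), 4); (A₂) itself; (2.8) for a general iterate; anything about lattice Yang–Mills
or the Clay problem.
-/

open Complex

namespace Literature.MathematicalPhysics.QuantumFieldTheory

namespace MullerSchiemann1987

namespace Theorem2Part3

/-- `G = SU(2)` (file-local shorthand as in the sibling `MullerSchiemann1987` files). -/
local notation "SU2" => Matrix.specialUnitaryGroup (Fin 2) ℂ

open HeatKernel (u0 u3 diagPhase u0_diagPhase_mul u3_diagPhase_mul u0_one u3_one)
open CentralAngle (fC etaOf thetaSq differentiableOn_fC four_fC_half_one_sub_cos)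

/-! ## §1 `‖cos w − 1‖ ≤ 2‖w‖` on the unit disc -/

/-- `‖cos w − 1‖ ≤ 2‖w‖` for `‖w‖ ≤ 1` (`cos w − 1 = ½[(e^{iw} − 1) + (e^{−iw} − 1)]`, Mathlib's
`‖e^z − 1‖ ≤ 2‖z‖`). [folklore] -/
private theorem norm_cos_sub_one_le {w : ℂ} (hw : ‖w‖ ≤ 1) : ‖Complex.cos w - 1‖ ≤ 2 * ‖w‖ := by
  have h1 : ‖Complex.exp (w * I) - 1‖ ≤ 2 * ‖w * I‖ := Complex.norm_exp_sub_one_le (by simpa using hw)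
  have h2 : ‖Complex.exp (-w * I) - 1‖ ≤ 2 * ‖-w * I‖ := Complex.norm_exp_sub_one_le (by simpa using hw)
  have hI1 : ‖w * I‖ = ‖w‖ := by simp
  have hI2 : ‖-w * I‖ = ‖w‖ := by simp
  rw [hI1] at h1; rw [hI2] at h2
  have e : Complex.cos w - 1 = ((Complex.exp (w * I) - 1) + (Complex.exp (-w * I) - 1)) / 2 := by
    rw [Complex.cos]; ring
  rw [e, norm_div, Complex.norm_ofNat]
  have := norm_add_le (Complex.exp (w * I) - 1) (Complex.exp (-w * I) - 1)
  linarith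

/-- `‖½(1 − cos w)‖ ≤ ‖w‖` for `‖w‖ ≤ 1`: the argument `η = ½(1 − cos w)` of `f` stays in the unit disc, the domain
of (2.13)/(2.15). [cite: MullerSchiemann1987, (2.13)–(2.15) pp.264–265] -/
theorem norm_half_one_sub_cos_le {w : ℂ} (hw : ‖w‖ ≤ 1) : ‖(1 - Complex.cos w) / 2‖ ≤ ‖w‖ := by
  rw [norm_div, Complex.norm_ofNat, norm_sub_rev]
  linarith [norm_cos_sub_one_le hw]

/-! ## §2 `4f(½(1 − cos w)) = w²` on the unit disc (identity theorem) -/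

/-- **`4f(½(1 − cos w)) = w²` for every complex `w` with `‖w‖ < 1`** — the complex form of the sibling's real identity
`four_fC_half_one_sub_cos` ((2.13) at `u = e^{−iwσ₃}`, `z = 0`), by the identity theorem on the unit disc (both sides
holomorphic there; they agree at the real points `w = t ↓ 0`). This is «Proposition 1 shows for |z| sufficiently small
|θ(e^{−ixσ₃}, iy)| = |z|» in function form. [cite: MullerSchiemann1987, Prop. 1 (2.13) p.264; p.281 L.33–34] -/
theorem four_fC_half_one_sub_cos_complex {w : ℂ} (hw : ‖w‖ < 1) :
    4 * fC ((1 - Complex.cos w) / 2) = w ^ 2 := by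
  have hball : w ∈ Metric.ball (0 : ℂ) 1 := by simpa using hw
  have hmaps : Set.MapsTo (fun w : ℂ => (1 - Complex.cos w) / 2) (Metric.ball 0 1) (Metric.ball 0 1) := by
    intro v hv
    rw [Metric.mem_ball, dist_zero_right] at hv ⊢
    exact lt_of_le_of_lt (norm_half_one_sub_cos_le hv.le) hv
  have hη : DifferentiableOn ℂ (fun w : ℂ => (1 - Complex.cos w) / 2) (Metric.ball 0 1) :=
    ((Complex.differentiable_cos.const_sub 1).div_const 2).differentiableOn
  have hF : DifferentiableOn ℂ (fun w : ℂ => 4 * fC ((1 - Complex.cos w) / 2)) (Metric.ball 0 1) :=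
    (differentiableOn_fC.comp hη hmaps).const_mul 4
  have hG : DifferentiableOn ℂ (fun w : ℂ => w ^ 2) (Metric.ball 0 1) := (differentiable_pow 2).differentiableOn
  have hFa := (Complex.analyticOnNhd_iff_differentiableOn Metric.isOpen_ball).mpr hF
  have hGa := (Complex.analyticOnNhd_iff_differentiableOn Metric.isOpen_ball).mpr hG
  refine hFa.eqOn_of_preconnected_of_frequently_eq hGa (convex_ball _ _).isPreconnected
    (Metric.mem_ball_self one_pos) ?_ hball
  refine Filter.frequently_iff.mpr fun {U} hU => ?_
  obtain ⟨ε, hε, hsub⟩ := Metric.mem_nhdsWithin_iff.mp hU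
  set t : ℝ := min (1 / 2) (ε / 2) with ht
  have ht0 : 0 < t := lt_min (by norm_num) (by positivity)
  have ht1 : t ≤ 1 / 2 := min_le_left _ _
  have ht2 : t ≤ ε / 2 := min_le_right _ _
  refine ⟨(t : ℂ), hsub ⟨?_, ?_⟩, ?_⟩
  · rw [Metric.mem_ball, dist_zero_right, Complex.norm_real, Real.norm_eq_abs, abs_of_pos ht0]; linarith
  · simp only [Set.mem_compl_iff, Set.mem_singleton_iff, Complex.ofReal_eq_zero]
    exact ht0.ne'
  · have hπ : |t| < Real.pi := by rw [abs_of_pos ht0]; linarith [Real.pi_gt_three]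
    show 4 * fC ((1 - Complex.cos (t : ℂ)) / 2) = (t : ℂ) ^ 2
    rw [← four_fC_half_one_sub_cos hπ]
    push_cast
    ring_nf

/-! ## §3 `θ²(e^{−ixσ₃}, z′) = (x + z′)²` -/

/-- `η(e^{−ixσ₃}, z′) = ½(1 − cos(x + z′))` ((2.17) for `u = e^{−ixσ₃}`: `u₀ = cos x`, `u₃ = −sin x`, and the addition
formula). [cite: MullerSchiemann1987, (2.13) p.264, (2.17) p.265] -/
theorem etaOf_diagPhase (x : ℝ) (z : ℂ) : etaOf (diagPhase x) z = (1 - Complex.cos ((x : ℂ) + z)) / 2 := by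
  have h0 : u0 (diagPhase x) = Real.cos x := by
    have := u0_diagPhase_mul x 1; rwa [mul_one, u0_one, u3_one, one_mul, zero_mul, add_zero] at this
  have h3 : u3 (diagPhase x) = -Real.sin x := by
    have := u3_diagPhase_mul x 1; rwa [mul_one, u0_one, u3_one, zero_mul, one_mul, zero_sub] at this
  rw [etaOf, h0, h3, Complex.cos_add, ← Complex.ofReal_cos, ← Complex.ofReal_sin]
  push_cast
  ring

/-- **`θ²(e^{−ixσ₃}, z′) = (x + z′)²` for `‖x + z′‖ < 1`** — at `z′ = iy`: «Proposition 1 shows for |z| sufficiently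
small |θ(e^{−ixσ₃}, iy)| = |z|», `z = x + iy`. [cite: MullerSchiemann1987, p.281 L.33–34 (proof of Theorem 2 part 3))] -/
theorem thetaSq_diagPhase (x : ℝ) {z : ℂ} (h : ‖(x : ℂ) + z‖ < 1) :
    thetaSq (diagPhase x) z = ((x : ℂ) + z) ^ 2 := by
  rw [thetaSq, etaOf_diagPhase, four_fC_half_one_sub_cos_complex h]

/-- `|θ²(e^{−ixσ₃}, iy)| = |z|²` for `z = x + iy`, `|z| < 1`. [cite: MullerSchiemann1987, p.281 L.33–34] -/
theorem norm_thetaSq_diagPhase (x y : ℝ) (h : ‖(x : ℂ) + y * I‖ < 1) :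
    ‖thetaSq (diagPhase x) (y * I)‖ = ‖(x : ℂ) + y * I‖ ^ 2 := by
  rw [thetaSq_diagPhase x h, norm_pow]

/-! ## §4 (2.18) and Theorem 2 part 3) -/

/-- **(2.18)** `𝒢[z, ϱ] := {u ∈ G : u₀ > 0 and |θ²(u, z)| < ϱ²}` — the small-field region around the unit element (with
`θ² = thetaSq` of the sibling, defined through `f` wherever `|η| < 1`). [cite: MullerSchiemann1987, (2.18) p.265] -/
def regionG (z : ℂ) (ρ : ℝ) : Set SU2 := {u | 0 < u0 u ∧ ‖thetaSq u z‖ < ρ ^ 2}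

/-- Membership in `𝒢[z, ϱ]`, unfolded. [cite: MullerSchiemann1987, (2.18) p.265] -/
theorem mem_regionG {z : ℂ} {ρ : ℝ} {u : SU2} : u ∈ regionG z ρ ↔ 0 < u0 u ∧ ‖thetaSq u z‖ < ρ ^ 2 := Iff.rfl

/-- For `z = x + iy` with `ϱ ≤ |z| < 1`: `e^{−ixσ₃} ∉ 𝒢[iy, ϱ]`, since `|θ²(e^{−ixσ₃}, iy)| = |z|² ≥ ϱ²` — the
hypothesis `u ∈ G∖𝒢[iy, β^{−α}]` of (A₂) at `u = e^{−ixσ₃}`, `ϱ = β^{−α}`.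
[cite: MullerSchiemann1987, (A₂) p.267, p.281 L.33–35] -/
theorem diagPhase_not_mem_regionG {x y ρ : ℝ} (hρ : 0 ≤ ρ) (h1 : ρ ≤ ‖(x : ℂ) + y * I‖)
    (h2 : ‖(x : ℂ) + y * I‖ < 1) : diagPhase x ∉ regionG (y * I) ρ := by
  intro hmem
  have h := hmem.2
  rw [norm_thetaSq_diagPhase x y h2] at h
  have : ρ ^ 2 ≤ ‖(x : ℂ) + y * I‖ ^ 2 := pow_le_pow_left₀ hρ h1 2
  linarith

/-- **THEOREM 2, PART 3) (p.281) BY ITS PRINTED PROOF, MODEL-FREE**: for any `g̃ : G × ℂ → ℂ` with the symmetry (2.8)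
`g̃(e^{−ixσ₃}u, z) = g̃(u, x + z)` and the nonperturbative bound (A₂) at scale `β > 0` («for |y| < (κ/2)β^{−α} and
u ∈ G∖𝒢[iy, β^{−α}], |g̃(u, iy)| < exp{βy² − pβ^{1−2α}}»), the function `h(z) = g̃(e₀, z)` ((6.15):
`h(z) = g̃(e₀, z) = g̃(e^{−ixσ₃}, iy)`) satisfies `|h(z)| < exp{βy² − pβ^{1−2α}}` for `z = x + iy` with
`β^{−α} ≤ |z| < 1` and `|y| < (κ/2)β^{−α}`. [cite: MullerSchiemann1987, Theorem 2 part 3) and (6.15) p.281] -/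
theorem thm2_part3 {gt : SU2 → ℂ → ℂ} (h28 : ∀ (x : ℝ) (U : SU2) (z : ℂ), gt (diagPhase x * U) z = gt U ((x : ℂ) + z))
    {β α p κ : ℝ} (hβ : 0 < β)
    (hA2 : ∀ y : ℝ, |y| < κ / 2 * β ^ (-α) → ∀ u : SU2, u ∉ regionG (y * I) (β ^ (-α)) →
      ‖gt u (y * I)‖ < Real.exp (β * y ^ 2 - p * β ^ (1 - 2 * α)))
    {x y : ℝ} (hz1 : β ^ (-α) ≤ ‖(x : ℂ) + y * I‖) (hz2 : ‖(x : ℂ) + y * I‖ < 1) (hy : |y| < κ / 2 * β ^ (-α)) :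
    ‖gt 1 ((x : ℂ) + y * I)‖ < Real.exp (β * y ^ 2 - p * β ^ (1 - 2 * α)) := by
  have h615 : gt 1 ((x : ℂ) + y * I) = gt (diagPhase x) (y * I) := by
    rw [← h28 x 1 (y * I), mul_one]
  rw [h615]
  exact hA2 y hy (diagPhase x) (diagPhase_not_mem_regionG (Real.rpow_nonneg hβ.le _) hz1 hz2)

end Theorem2Part3

end MullerSchiemann1987

end Literature.MathematicalPhysics.QuantumFieldTheory
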